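import Literature.AlgebraicGeometry.Frobenioids.Prop25SubPsiProofs
import Literature.AlgebraicGeometry.Frobenioids.Prop25SubProofs
import Literature.AlgebraicGeometry.Frobenioids.UnitWiseFrobeniusHolds
import HarnessLib

/-!
# [FrdI] Corollary 2.6, sub-DAG rows C26-L02 – L05 and the assembly C26-L00: the unit-wise Frobenius
# functor `Ψ := Ψ₂ ∘ Ψ₁` of ANY `Cor26Data` IS the landed one — discharge of `UnitWise_a`, `UnitWise_b`,
# `UnitWise_c`, `UnitWise_d`

Mochizuki, *The geometry of Frobenioids I: the general theory*, Kyushu J. Math. **62** (2008)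
293–400, §2, Corollary 2.6 (statement p. 50 l. 32 – p. 51 l. 4, proof p. 51 ll. 5–17)
[cite: MochizukiFrdI2008, Cor. 2.6 p.50].

PROOF-ONLY companion of `Prop25Sub.lean` (statements, abc-iut-L1-t2, p414336; sub-DAG
`plan/L1/SUBDAG-FrdI-Prop25-Cor26.md`).  The rows C26-L02 – L05 are the clauses (a)–(d) of Cor. 2.6
for the functor `Δ.psi = Δ.Ψ₁ ⋙ Δ.U.functor⁻¹` of an arbitrary `Cor26Data τ d hF` ("write
`Ψ₁ : C → C(d)` for the resulting functor.  Next, let us write `Ψ₂ : C(d) → C` for some quasi-inverse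
… Set `Ψ := Ψ₂ ∘ Ψ₁`", p. 51 ll. 7–9).  The data are RIGID: `Δ.Ψ₁` is determined by
`Δ.Ψ₁ ⋙ (C(d) ⊆ C) = ` the naive Frobenius functor (the inclusion is faithful and injective on objects;
`Cor26Data.Ψ₁_eq`) and `Δ.U` by its `Ψ`-values (`unitLinearFrobeniusData_eq_of_isPsiValue`,
`Prop25SubPsiProofs.lean`), so `Δ.psi` IS the unit-wise Frobenius functor
`PreFrobenioid.CharacteristicSplitting.unitWiseFrobenius` of `UnitWiseFrobenius.lean` (abc-iut-L6-t9,
p412055) for the Frobenius choice underlying `naiveFrobeniusOf` (`Cor26Data.psi_eq`), and (a)–(d) are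
the LANDED `unitWiseFrobenius_spec` (`UnitWiseFrobeniusExists.lean`: (a) cancellation of the
Frobenius functor of `F_Φ`, Props. 2.1 (ii) + 2.5 (iii)(b); (b) Prop. 2.5 (ii) + the `ζ`-conjugate
formula; (c) Prop. 2.1 (ii) "Moreover" on Frobenius-trivial objects; (d) Prop. 2.1 (iii)
(`naiveFrobeniusEquivalenceOfPerfect_holds`, abc-iut-L1-d7) and Rem. 2.5.1).  Closers BY NAME:
`unitWise_a_holds` (C26-L02), `unitWise_b_holds` (L03), `unitWise_c_holds` (L04), `unitWise_d_holds`
(L05); C26-L00: the typer's PROVED assembly `assembly26` fed with the discharged rows (C26-L01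
`naiveFactorsThroughCd_holds`, abc-iut-L1-t2; P25-L07/L08, `Prop25SubPsiProofs.lean`) — an `example`
at the end of the file.  No new definitions; typed ≠ proved elsewhere; no side taken on anything
beyond [FrdI] §2.
-/

namespace Literature.AlgebraicGeometry.Frobenioids

open CategoryTheory Opposite

namespace FrdI.P25

open PreFrobenioid PreFrobenioid.CharacteristicSplitting

universe w v v' u u'

variable {D : Type u} [Category.{v} D] {Φ : Dᵒᵖ ⥤ CommMonCat.{w}}
  {C : Type u'} [Category.{v'} C] {F : C ⥤ ElemFrobenioid Φ}

/-! ### Rigidity of the data `Ψ₁`, `U` -/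

/-- A functor into a wide subcategory is determined by its composite with the (faithful, injective on
objects) inclusion — "factors naturally through the subcategory `C(d) ⊆ C`" determines `Ψ₁`.
[cite: MochizukiFrdI2008, Cor. 2.6 p.51] -/
theorem functor_eq_of_comp_wideSubcategoryInclusion_eq {E : Type*} [Category E]
    {P : MorphismProperty C} [P.IsMultiplicative] {G G' : E ⥤ WideSubcategory P}
    (h : G ⋙ wideSubcategoryInclusion P = G' ⋙ wideSubcategoryInclusion P) : G = G' := by
  have hobj : ∀ X, G.obj X = G'.obj X := fun X => WideSubcategory.ext (Functor.congr_obj h X)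
  refine CategoryTheory.Functor.ext hobj fun X Y f => ?_
  apply (wideSubcategoryInclusion P).map_injective
  rw [Functor.map_comp, Functor.map_comp, eqToHom_map, eqToHom_map]
  exact Functor.congr_hom h f

variable {τ : CharacteristicSplitting F} {d : ℕ+}

/-- `Ψ₁` of a `Cor26Data` IS the lift `naiveFrobeniusCd` of the naive Frobenius functor
`naiveFrobeniusOf hF d` (same Frobenius choice). [cite: MochizukiFrdI2008, Cor. 2.6 p.51] -/
theorem Cor26Data.Ψ₁_eq {hF : IsFrobenioid F} (Δ : Cor26Data τ d hF) :
    Δ.Ψ₁ = naiveFrobeniusCd (nonempty_frobeniusChoice F hF d).some (hasFrobeniusLifts hF d) :=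
  functor_eq_of_comp_wideSubcategoryInclusion_eq Δ.Ψ₁_spec

/-- **`Ψ := Ψ₂ ∘ Ψ₁` of ANY `Cor26Data` is the landed unit-wise Frobenius functor** (for the Frobenius
choice underlying `naiveFrobeniusOf`): `Ψ₁` and the unit-linear Frobenius datum are determined, and
"some quasi-inverse" `Ψ₂` is `Functor.inv`. [cite: MochizukiFrdI2008, Cor. 2.6 p.51] -/
theorem Cor26Data.psi_eq (hS : Setting F) (Δ : Cor26Data τ d hS.isFrobenioid) :
    Δ.psi = unitWiseFrobenius hS.isFrobenioid τ hS.metricallyTrivial hS.autAmple hS.frobeniusNormalized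
      d (nonempty_frobeniusChoice F hS.isFrobenioid d).some := by
  have h1 := Δ.Ψ₁_eq
  have h2 := unitLinearFrobeniusData_eq_of_isPsiValue hS τ d Δ.U Δ.U_spec
  obtain ⟨Ψ₁, hΨ₁, U, hU, hE⟩ := Δ
  dsimp only at h1 h2
  subst h1 h2
  rfl

/-! ### The rows -/

section Rows

variable (τ : CharacteristicSplitting F) (d : ℕ+)

/-- **Row C26-L02 `UnitWise_a` DISCHARGED** — Cor. 2.6 (a): `Ψ` is `1`-compatible, relative to
`C → F_Φ`, with the identity of `F_Φ` ("it follows immediately from Propositions 2.1, (ii); 2.5,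
(iii), (b)", p. 51 ll. 9–10; `unitWiseFrobenius_oneCommutes`). [cite: MochizukiFrdI2008, Cor. 2.6 p.50] -/
theorem unitWise_a_holds : Literature.AlgebraicGeometry.Frobenioids.FrdI.P25.UnitWise_a F τ d := by
  intro hS hF Δ
  rw [Cor26Data.psi_eq hS Δ]
  exact unitWiseFrobenius_oneCommutes hS.isFrobenioid τ hS.metricallyTrivial hS.autAmple
    hS.frobeniusNormalized d _

/-- **Row C26-L03 `UnitWise_b` DISCHARGED** — Cor. 2.6 (b): `Ψ` maps an object (resp. a morphism of
Frobenius type / pre-step / pull-back morphism) of `C^istr` to an isomorphic object (resp. an abstractly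
equivalent morphism) (p. 51 ll. 10–14; Prop. 2.5 (ii) and the construction of `Ψ₁`, `Ψ₂` —
`unitWiseFrobenius_spec`, `unitWiseFrobenius_arrows`). [cite: MochizukiFrdI2008, Cor. 2.6 p.50] -/
theorem unitWise_b_holds : Literature.AlgebraicGeometry.Frobenioids.FrdI.P25.UnitWise_b F τ d := by
  intro hS hF Δ
  rw [Cor26Data.psi_eq hS Δ]
  have sp := unitWiseFrobenius_spec hS.isFrobenioid τ hS.metricallyTrivial hS.autAmple
    hS.frobeniusNormalized d (nonempty_frobeniusChoice F hS.isFrobenioid d).some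
    (naiveFrobeniusEquivalenceOfPerfect_holds d)
  exact ⟨sp.2.1, fun A B φ hA hB hφ => sp.2.2.1 φ hA hB hφ⟩

/-- **Row C26-L04 `UnitWise_c` DISCHARGED** — Cor. 2.6 (c): for `A ∈ Ob(C^istr)` an isomorphism
`Ψ(A) ≅ A` conjugating `Ψ` on `O^×(A)` into `u ↦ u^d` (p. 51 ll. 14–17; `unitWiseFrobenius_units`:
Prop. 2.1 (ii) "Moreover" on the Frobenius-trivial `A`, Prop. 2.5 (ii)).
[cite: MochizukiFrdI2008, Cor. 2.6 p.50] -/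
theorem unitWise_c_holds : Literature.AlgebraicGeometry.Frobenioids.FrdI.P25.UnitWise_c F τ d := by
  intro hS hF Δ A hA
  rw [Cor26Data.psi_eq hS Δ]
  exact unitWiseFrobenius_units hS.isFrobenioid τ hS.metricallyTrivial hS.autAmple
    hS.frobeniusNormalized d _ hA

/-- **Row C26-L05 `UnitWise_d` DISCHARGED** — Cor. 2.6 (d): `C` of perfect type ⇒ `Ψ` is an
equivalence (Prop. 2.1 (iii), `naiveFrobeniusEquivalenceOfPerfect_holds`); `d = 1` or `C` of isotropic
and unit-trivial type ⇒ `Ψ ≅ id` (Rem. 2.5.1) (p. 51 ll. 1–4, 14–17; `unitWiseFrobenius_spec`).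
[cite: MochizukiFrdI2008, Cor. 2.6 p.51] -/
theorem unitWise_d_holds : Literature.AlgebraicGeometry.Frobenioids.FrdI.P25.UnitWise_d F τ d := by
  intro hS hF Δ
  rw [Cor26Data.psi_eq hS Δ]
  exact (unitWiseFrobenius_spec hS.isFrobenioid τ hS.metricallyTrivial hS.autAmple
    hS.frobeniusNormalized d (nonempty_frobeniusChoice F hS.isFrobenioid d).some
    (naiveFrobeniusEquivalenceOfPerfect_holds d)).2.2.2.2

end Rows

/-! ### Row C26-L00 `Assembly26`

The typer's PROVED assembly `assembly26` fed with the discharged rows C26-L01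
(`naiveFactorsThroughCd_holds`, abc-iut-L1-t2), P25-L07 (`psiUnitLinearData_holds`), P25-L08
(`psiEquivalence_holds`) and C26-L02 – L05 above re-proves the landed Cor. 2.6
`PreFrobenioid.unitWiseFrobeniusExists` (p414661) along the sub-DAG; it is recorded as an `example`
(the gate's dedup forbids a second theorem with the landed statement). -/

/-- **Row C26-L00 `Assembly26` CLOSED** (kernel-checked instantiation; no new declaration).
[cite: MochizukiFrdI2008, Cor. 2.6 p.50] -/
example (d : ℕ+) :
    Literature.AlgebraicGeometry.Frobenioids.PreFrobenioid.UnitWiseFrobeniusExists F d :=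
  assembly26 F d (naiveFactorsThroughCd_holds F d) (fun τ => psiUnitLinearData_holds τ d)
    (fun τ => psiEquivalence_holds τ d) (fun τ => unitWise_a_holds τ d) (fun τ => unitWise_b_holds τ d)
    (fun τ => unitWise_c_holds τ d) (fun τ => unitWise_d_holds τ d)

end FrdI.P25

end Literature.AlgebraicGeometry.Frobenioids
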